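import Mathlib
import Summits.Ventures.PercRepro.TriangleCapFourRowThreeCapStrict
import Summits.Ventures.PercRepro.TriangleCapThirdOrderTenLocus
import Summits.Ventures.PercRepro.TriangleCapFourRowThree

/-!
# PercRepro — THE PIECES OF THE SECOND-ORDER LOCUS ON `(k, 4, 3)` (p3, gen 46; part 199l)

For part 199m (every non-`4`-bipartite `K₄⁻`-free graph on `(k, 4, 3)`, `k ≥ 11`, at the non-bipartite second-best
value `m k − 3 (k − 4) − (2k − 18)` is `5`-bipartite — `K_{5,k−5}` minus a `(k − 6)`-star): a deletion of a vertex `z` of degree `4` onto a `4`-bipartite `D − z` with the neighbours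
of `z` on both sides loses at least `2` against the crude count — a neighbour `b` off the `4`-side is adjacent to at
most one neighbour of `z` on it (`not_adj_both`), so `d(b) ≤ 5 − j` where `j` counts the neighbours on the side
(`four_three_mixed_T_strict`: `T ≤ 3 (k − 6) + 2`); at the corner `k = 11` the deletion onto `(10, 21)` at `190`
with all four neighbours of degree `5` reads part 199j's locus `K_{5,5}` minus a `4`-star — the neighbours of `z`
on its `5`-side make `D` `5`-bipartite, all off it make `D` `5`-bipartite with the other side, and a mixture is a
`K₄⁻` (`four_three_corner_third_exact`); the strict arithmetic of the deletions (`…_false`) and the two exact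
reads (`four_three_del_four_eq`, `four_three_del_four_ten_eq`). Axioms: standard.
-/

namespace PercRepro

namespace TriangleCap

namespace C047

open Finset

variable {V : Type*} [Fintype V] [DecidableEq V]

/-- **THE MIXED DELETION ONTO A `4`-BIPARTITE `D − z` LOSES `2`:** with the four neighbours of `z` not all on one
side of `A'` (`|A'| = 4`), every neighbour off `A'` is adjacent to at most one neighbour on `A'` (`not_adj_both`),
so `T ≤ j (k − 6) + (4 − j)(5 − j) ≤ 3 (k − 6) + 2` (`k ≥ 11`). -/
theorem four_three_mixed_T_strict (D : SimpleGraph V) [DecidableRel D.Adj] (hK : K4mFree D)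
    (hk : 11 ≤ Fintype.card V) (z : V) (hz : deg D z = 4) (A' : Finset {v : V // v ≠ z}) (hA'card : A'.card = 4)
    (hB : BipSub (del D z) A') (hcap6 : ∀ v, deg D v ≤ (Fintype.card V - 6) + 1)
    (hin : ∃ a : {v : V // v ≠ z}, D.Adj a.1 z ∧ a ∈ A') (hout : ∃ b : {v : V // v ≠ z}, D.Adj b.1 z ∧ b ∉ A') :
    ∑ a : {v : V // v ≠ z}, (if D.Adj a.1 z then deg (del D z) a else 0) ≤ 3 * (Fintype.card V - 6) + 2 := by
  obtain ⟨Nz, hNzdef⟩ : ∃ Nz : Finset {v : V // v ≠ z},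
      Nz = univ.filter (fun a : {v : V // v ≠ z} => D.Adj a.1 z) := ⟨_, rfl⟩
  have hmemNz : ∀ a : {v : V // v ≠ z}, a ∈ Nz ↔ D.Adj a.1 z := fun a => by
    rw [hNzdef, mem_filter]
    simp only [mem_univ, true_and]
  have hNz : Nz.card = 4 := by rw [hNzdef, card_nbhd_del, hz]
  have hTfilt : ∑ a : {v : V // v ≠ z}, (if D.Adj a.1 z then deg (del D z) a else 0) =
      ∑ a ∈ Nz, deg (del D z) a := by
    rw [hNzdef, sum_filter]
  rw [hTfilt]
  -- the neighbours on `A'` (`P`, `j` of them) and off it (`Q`)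
  obtain ⟨P, hPdef⟩ : ∃ P : Finset {v : V // v ≠ z}, P = Nz.filter (fun a => a ∈ A') := ⟨_, rfl⟩
  obtain ⟨Q, hQdef⟩ : ∃ Q : Finset {v : V // v ≠ z}, Q = Nz.filter (fun a => a ∉ A') := ⟨_, rfl⟩
  have hmemP : ∀ a, a ∈ P ↔ a ∈ Nz ∧ a ∈ A' := fun a => by rw [hPdef, mem_filter]
  have hmemQ : ∀ a, a ∈ Q ↔ a ∈ Nz ∧ a ∉ A' := fun a => by rw [hQdef, mem_filter]
  have hsplit : ∑ a ∈ Nz, deg (del D z) a = ∑ a ∈ P, deg (del D z) a + ∑ a ∈ Q, deg (del D z) a := by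
    rw [hPdef, hQdef, sum_filter_add_sum_filter_not]
  have hcardPQ : P.card + Q.card = 4 := by
    rw [hPdef, hQdef, card_filter_add_card_filter_not, hNz]
  obtain ⟨j, hj⟩ : ∃ j, P.card = j := ⟨_, rfl⟩
  have hj1 : 1 ≤ j := by
    obtain ⟨a, haz, haA⟩ := hin
    have : a ∈ P := (hmemP a).mpr ⟨(hmemNz a).mpr haz, haA⟩
    rw [← hj]
    exact card_pos.mpr ⟨a, this⟩
  have hj3 : j ≤ 3 := by
    obtain ⟨b, hbz, hbA⟩ := hout
    have : b ∈ Q := (hmemQ b).mpr ⟨(hmemNz b).mpr hbz, hbA⟩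
    have := card_pos.mpr ⟨b, this⟩
    omega
  -- on `P`: degree `≤ k − 6`
  have hPsum : ∑ a ∈ P, deg (del D z) a ≤ j * (Fintype.card V - 6) := by
    have : ∀ a ∈ P, deg (del D z) a ≤ Fintype.card V - 6 := by
      intro a ha
      have h := deg_del D z a
      rw [if_pos ((hmemNz a).mp ((hmemP a).mp ha).1)] at h
      have := hcap6 a.1
      omega
    have := sum_le_sum this
    rw [sum_const, smul_eq_mul, hj] at this
    exact this
  -- on `Q`: degree `≤ 5 − j`: `b` is adjacent to at most one vertex of `P`
  have hQdeg : ∀ b ∈ Q, deg (del D z) b + j ≤ 5 := by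
    intro b hb
    obtain ⟨hbNz, hbA⟩ := (hmemQ b).mp hb
    have hbz : D.Adj b.1 z := (hmemNz b).mp hbNz
    -- at most one vertex of `P` is adjacent to `b`
    have hone : (P.filter (fun a => (del D z).Adj b a)).card ≤ 1 := by
      apply card_le_one.mpr
      intro a₁ ha₁ a₂ ha₂
      rw [mem_filter] at ha₁ ha₂
      by_contra h12
      have ha₁z : D.Adj a₁.1 z := (hmemNz a₁).mp ((hmemP a₁).mp ha₁.1).1
      have ha₂z : D.Adj a₂.1 z := (hmemNz a₂).mp ((hmemP a₂).mp ha₂.1).1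
      exact not_adj_both D hK (D.adj_symm hbz) (D.adj_symm ha₁z) ((del_adj D z b a₁).mp ha₁.2)
        (fun h => h12 (Subtype.ext h)) (D.adj_symm ha₂z) ((del_adj D z b a₂).mp ha₂.2)
    -- the neighbours of `b` lie in `A'`, and miss at least `j − 1` vertices of `P ⊆ A'`
    have hnbsub : univ.filter (fun a => (del D z).Adj b a) ⊆ A' := by
      intro a ha
      rw [mem_filter] at ha
      have := hB b a ha.2
      tauto
    have hPsub : P ⊆ A' := fun a ha => ((hmemP a).mp ha).2
    have hmiss : (P.filter (fun a => ¬ (del D z).Adj b a)).card + 1 ≥ j := by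
      have := card_filter_add_card_filter_not (s := P) (p := fun a => (del D z).Adj b a)
      rw [hj] at this
      omega
    have hmiss' : (P.filter (fun a => ¬ (del D z).Adj b a)) ⊆ A' \ univ.filter (fun a => (del D z).Adj b a) := by
      intro a ha
      rw [mem_filter] at ha
      rw [mem_sdiff, mem_filter]
      exact ⟨hPsub ha.1, fun h => ha.2 h.2⟩
    have h1 := card_le_card hmiss'
    rw [card_sdiff_of_subset hnbsub, hA'card] at h1
    have h2 := card_le_card hnbsub
    rw [hA'card] at h2
    unfold deg
    omega
  have hQsum : ∑ b ∈ Q, deg (del D z) b + Q.card * j ≤ Q.card * 5 := by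
    have := sum_le_sum hQdeg
    rw [sum_add_distrib, sum_const, sum_const, smul_eq_mul, smul_eq_mul] at this
    exact this
  have hQcard : Q.card = 4 - j := by omega
  rw [hQcard] at hQsum
  rw [hsplit]
  have hk6 : 5 ≤ Fintype.card V - 6 := by omega
  interval_cases j <;> omega

/-- **THE CORNER'S WITHIN-ROW DELETION AT THE THIRD ORDER, EXACT:** `k = 11`, `z` of degree `4`, `D − z` on `(10, 21)`
neither `3`- nor `4`-bipartite at `190`, all four neighbours of `z` of degree `5` in `D − z` ⇒ `D` is `5`-bipartite. -/
theorem four_three_corner_third_exact (D : SimpleGraph V) [DecidableRel D.Adj] (hK : K4mFree D)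
    (hk : Fintype.card V = 11) (z : V) (hz : deg D z = 4)
    (h3 : ¬ ∃ A' : Finset {v : V // v ≠ z}, A'.card = 3 ∧ BipSub (del D z) A')
    (h4 : ¬ ∃ A' : Finset {v : V // v ≠ z}, A'.card = 4 ∧ BipSub (del D z) A')
    (hm' : (del D z).edgeFinset.card = 21)
    (heq' : ∑ a : {v : V // v ≠ z}, deg (del D z) a * deg (del D z) a + 20 =
      (del D z).edgeFinset.card * Fintype.card {v : V // v ≠ z})
    (hT : ∀ a : {v : V // v ≠ z}, D.Adj a.1 z → deg (del D z) a = 5) :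
    ∃ A : Finset V, A.card = 5 ∧ BipSub D A := by
  have hcard' := card_del z
  have hcard10 : Fintype.card {v : V // v ≠ z} = 10 := by omega
  obtain ⟨A'', hA''card, hB⟩ := three_diag_third_locus_ten (del D z) (k4mFree_del D hK z) hcard10 hm' h3 h4 heq'
  by_cases hall : ∀ a : {v : V // v ≠ z}, D.Adj a.1 z → a ∈ A''
  · obtain ⟨B, hBcard, hBsub⟩ := bipSub_lift D z A'' hB hall
    exact ⟨B, by rw [hBcard, hA''card], hBsub⟩
  by_cases hnone : ∀ a : {v : V // v ≠ z}, D.Adj a.1 z → a ∉ A''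
  · obtain ⟨A, hAcard, hAsub⟩ := bipSub_insert_of_nbhd_off D z A'' hB hnone
    refine ⟨Aᶜ, ?_, bipSub_compl D A hAsub⟩
    rw [card_compl, hAcard, hA''card, hk]
  · -- a mixture: an off-side neighbour of degree `5 = |A''|` is adjacent to all of `A''`
    exfalso
    push Not at hall hnone
    obtain ⟨b, hbz, hbA⟩ := hall
    obtain ⟨a, haz, haA⟩ := hnone
    have hbfull := adj_all_of_deg_eq_card (del D z) A'' hB b hbA (by rw [hT b hbz, hA''card])
    obtain ⟨Nz, hNzdef⟩ : ∃ Nz : Finset {v : V // v ≠ z},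
        Nz = univ.filter (fun a : {v : V // v ≠ z} => D.Adj a.1 z) := ⟨_, rfl⟩
    have hmemNz : ∀ a : {v : V // v ≠ z}, a ∈ Nz ↔ D.Adj a.1 z := fun a => by
      rw [hNzdef, mem_filter]
      simp only [mem_univ, true_and]
    have hNz : Nz.card = 4 := by rw [hNzdef, card_nbhd_del, hz]
    -- a third neighbour `c`, distinct from `a` and `b`
    have hab : a ≠ b := fun h => hbA (h ▸ haA)
    obtain ⟨c, hcz, hca, hcb⟩ : ∃ c : {v : V // v ≠ z}, D.Adj c.1 z ∧ c ≠ a ∧ c ≠ b := by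
      by_contra hcon
      push Not at hcon
      have hsub : Nz ⊆ {a, b} := by
        intro t ht
        rw [mem_insert, mem_singleton]
        by_contra h
        push Not at h
        exact h.2 (hcon t ((hmemNz t).mp ht) h.1)
      have := card_le_card hsub
      have h2 : ({a, b} : Finset {v : V // v ≠ z}).card ≤ 2 := card_le_two
      omega
    by_cases hcA : c ∈ A''
    · -- `a, c ∈ A''` both adjacent to `b`: the triangles `z a b`, `z c b` share `z b`
      have h1 : D.Adj b.1 a.1 := (del_adj D z b a).mp (hbfull a haA)
      have h2 : D.Adj b.1 c.1 := (del_adj D z b c).mp (hbfull c hcA)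
      exact not_adj_both D hK (D.adj_symm hbz) (D.adj_symm haz) h1 (fun h => hca (Subtype.ext h).symm)
        (D.adj_symm hcz) h2
    · -- `b, c ∉ A''` both of degree `5`, adjacent to `a`: the triangles `z a b`, `z a c` share `z a`
      have hcfull := adj_all_of_deg_eq_card (del D z) A'' hB c hcA (by rw [hT c hcz, hA''card])
      have h1 : D.Adj b.1 a.1 := (del_adj D z b a).mp (hbfull a haA)
      have h2 : D.Adj c.1 a.1 := (del_adj D z c a).mp (hcfull a haA)
      exact not_adj_both D hK (D.adj_symm haz) (D.adj_symm hbz) (D.adj_symm h1)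
        (fun h => hcb (Subtype.ext h).symm) (D.adj_symm hcz) (D.adj_symm h2)

/-- `d = 0`, `k ≥ 12`: the closed form on `(k − 1, 5, k − 11)` is strict against equality. -/
theorem four_three_del_zero_false (s m' S' T : ℕ) (hs : 1 ≤ s) (hm' : m' = 4 * s + 25)
    (hS' : S' + (s + 11 - 11) * 9 ≤ m' * (s + 10)) (hT : T ≤ 0 * (s + 11 - 6))
    (heq : S' + 2 * T + 0 + 0 * 0 + 3 * (s + 11 - 4) + (2 * (s + 11) - 18) = (m' + 0) * (s + 11)) : False := by
  subst hm'
  have e1 : s + 11 - 11 = s := by omega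
  have e2 : s + 11 - 4 = s + 7 := by omega
  have e3 : 2 * (s + 11) - 18 = 2 * s + 4 := by omega
  rw [e1] at hS'
  rw [e2, e3] at heq
  have hT0 : T = 0 := by omega
  subst hT0
  nlinarith [hS', heq]

/-- `d = 1`, `D − z` not `4`-bipartite: strict. -/
theorem four_three_del_one_gap_false (s m' S' T : ℕ) (hm' : m' = 4 * s + 24)
    (hS' : S' + 2 * 4 * (s + 10 - 2 * 4 - 1) ≤ m' * (s + 10)) (hT : T ≤ 1 * (s + 11 - 6))
    (heq : S' + 2 * T + 1 + 1 * 1 + 3 * (s + 11 - 4) + (2 * (s + 11) - 18) = (m' + 1) * (s + 11)) : False := by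
  subst hm'
  have e1 : s + 10 - 2 * 4 - 1 = s + 1 := by omega
  have e2 : s + 11 - 4 = s + 7 := by omega
  have e3 : 2 * (s + 11) - 18 = 2 * s + 4 := by omega
  have e4 : s + 11 - 6 = s + 5 := by omega
  rw [e1] at hS'
  rw [e4] at hT
  rw [e2, e3] at heq
  nlinarith [hS', hT, heq]

/-- `d = 2`, mixed onto a `4`-bipartite `D − z`: strict (slack `4`). -/
theorem four_three_del_two_mixed_false (s m' S' T : ℕ) (hm' : m' = 4 * s + 23)
    (hS' : S' + 1 * (s + 10 - 1 - 1) ≤ m' * (s + 10)) (hT : T + (s + 11 - 6) ≤ 2 * (s + 11 - 6) + 4)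
    (heq : S' + 2 * T + 2 + 2 * 2 + 3 * (s + 11 - 4) + (2 * (s + 11) - 18) = (m' + 2) * (s + 11)) : False := by
  subst hm'
  have e1 : s + 10 - 1 - 1 = s + 8 := by omega
  have e2 : s + 11 - 4 = s + 7 := by omega
  have e3 : 2 * (s + 11) - 18 = 2 * s + 4 := by omega
  have e4 : s + 11 - 6 = s + 5 := by omega
  rw [e1] at hS'
  rw [e4] at hT
  rw [e2, e3] at heq
  nlinarith [hS', hT, heq]

/-- `d = 2`, `D − z` not `4`-bipartite: strict (slack `4k − 36`). -/
theorem four_three_del_two_gap_false (s m' S' T : ℕ) (hm' : m' = 4 * s + 23)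
    (hS' : S' + (s + 10 - 2) + 2 * (s + 10 - 2 * 4 - 1) * (4 - 1) ≤ m' * (s + 10)) (hT : T ≤ 2 * (s + 11 - 6))
    (heq : S' + 2 * T + 2 + 2 * 2 + 3 * (s + 11 - 4) + (2 * (s + 11) - 18) = (m' + 2) * (s + 11)) : False := by
  subst hm'
  have e1 : s + 10 - 2 * 4 - 1 = s + 1 := by omega
  have e1' : s + 10 - 2 = s + 8 := by omega
  have e2 : s + 11 - 4 = s + 7 := by omega
  have e3 : 2 * (s + 11) - 18 = 2 * s + 4 := by omega
  have e4 : s + 11 - 6 = s + 5 := by omega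
  rw [e1, e1'] at hS'
  rw [e4] at hT
  rw [e2, e3] at heq
  nlinarith [hS', hT, heq]

/-- `d = 3`, mixed onto a `4`-bipartite `D − z`: strict (slack `4`). -/
theorem four_three_del_three_mixed_false (s m' S' T : ℕ) (hm' : m' = 4 * s + 22)
    (hS' : S' + 2 * (s + 10 - 1 - 2) ≤ m' * (s + 10)) (hT : T + (s + 11 - 6) ≤ 3 * (s + 11 - 6) + 4)
    (heq : S' + 2 * T + 3 + 3 * 3 + 3 * (s + 11 - 4) + (2 * (s + 11) - 18) = (m' + 3) * (s + 11)) : False := by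
  subst hm'
  have e1 : s + 10 - 1 - 2 = s + 7 := by omega
  have e2 : s + 11 - 4 = s + 7 := by omega
  have e3 : 2 * (s + 11) - 18 = 2 * s + 4 := by omega
  have e4 : s + 11 - 6 = s + 5 := by omega
  rw [e1] at hS'
  rw [e4] at hT
  rw [e2, e3] at heq
  nlinarith [hS', hT, heq]

/-- `d = 3`, `D − z` not `4`-bipartite: strict (slack `4`). -/
theorem four_three_del_three_gap_false (s m' S' T : ℕ) (hm' : m' = 4 * s + 22)
    (hS' : S' + 2 * (s + 10 - 3) + 2 * (s + 10 - 9) ≤ m' * (s + 10)) (hT : T ≤ 3 * (s + 11 - 6))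
    (heq : S' + 2 * T + 3 + 3 * 3 + 3 * (s + 11 - 4) + (2 * (s + 11) - 18) = (m' + 3) * (s + 11)) : False := by
  subst hm'
  have e1 : s + 10 - 3 = s + 7 := by omega
  have e1' : s + 10 - 9 = s + 1 := by omega
  have e2 : s + 11 - 4 = s + 7 := by omega
  have e3 : 2 * (s + 11) - 18 = 2 * s + 4 := by omega
  have e4 : s + 11 - 6 = s + 5 := by omega
  rw [e1, e1'] at hS'
  rw [e4] at hT
  rw [e2, e3] at heq
  nlinarith [hS', hT, heq]

/-- `d = 4`, mixed onto a `4`-bipartite `D − z` with the `K₄⁻` refinement `T ≤ 3 (k − 6) + 2`: strict (slack `4`). -/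
theorem four_three_del_four_mixed_false (s m' S' T : ℕ) (hm' : m' = 4 * s + 21)
    (hS' : S' + 3 * (s + 10 - 1 - 3) ≤ m' * (s + 10)) (hT : T ≤ 3 * (s + 11 - 6) + 2)
    (heq : S' + 2 * T + 4 + 4 * 4 + 3 * (s + 11 - 4) + (2 * (s + 11) - 18) = (m' + 4) * (s + 11)) : False := by
  subst hm'
  have e1 : s + 10 - 1 - 3 = s + 6 := by omega
  have e2 : s + 11 - 4 = s + 7 := by omega
  have e3 : 2 * (s + 11) - 18 = 2 * s + 4 := by omega
  have e4 : s + 11 - 6 = s + 5 := by omega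
  rw [e1] at hS'
  rw [e4] at hT
  rw [e2, e3] at heq
  nlinarith [hS', hT, heq]

/-- `d = 4`, `k ≥ 12`, `D − z` not `4`-bipartite: equality forces `D − z` at its second-best value and `T = 4 (k − 6)`. -/
theorem four_three_del_four_eq (s m' S' T : ℕ) (hm' : m' = 4 * s + 21)
    (hS' : S' + 3 * (s + 10 - 4) + (2 * (s + 10) - 18) ≤ m' * (s + 10)) (hT : T ≤ 4 * (s + 11 - 6))
    (heq : S' + 2 * T + 4 + 4 * 4 + 3 * (s + 11 - 4) + (2 * (s + 11) - 18) = (m' + 4) * (s + 11)) :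
    S' + 3 * (s + 10 - 4) + (2 * (s + 10) - 18) = m' * (s + 10) ∧ T = 4 * (s + 11 - 6) := by
  subst hm'
  have e1 : s + 10 - 4 = s + 6 := by omega
  have e1' : 2 * (s + 10) - 18 = 2 * s + 2 := by omega
  have e2 : s + 11 - 4 = s + 7 := by omega
  have e3 : 2 * (s + 11) - 18 = 2 * s + 4 := by omega
  have e4 : s + 11 - 6 = s + 5 := by omega
  rw [e1, e1'] at hS' ⊢
  rw [e4] at hT ⊢
  rw [e2, e3] at heq
  constructor <;> nlinarith [hS', hT, heq]

end C047

end TriangleCap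

end PercRepro
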